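/-
Copyright: width seat `ym-line-sgb-p1-w2` (prover-ym-line-sgb-p1-w2-g0-0), route `SteinGapBootstrap` (rev 2), support item
`AxisSymmetryG` (stmt-QuantumFields-23001).
-/
import Summits.QuantumFields.YangMills.Theses.SteinGapBootstrap
import Literature.MathematicalPhysics.QuantumFieldTheory.LatticeGaugeStaticPotentialProofs
import HarnessLib

/-!
# Route `SteinGapBootstrap`, support item `AxisSymmetryG` (stmt-QuantumFields-23001): torus-limit states are invariant under the
# coordinate permutations, PROVED

NOT THE CLAY GAP (the route closes the RECORD-label rung leaf `WeakCouplingRates.XiPow`, an UPPER bound on lattice gaps; this file is a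
symmetry bookkeeping fact about torus-limit states and says nothing about any gap).

`AxisSymmetryG`: for every compact simple `G`, faithful unitary lattice representation `r`, real `β`, every
`μ ∈ infiniteVolumeLimitPoints r.ρ β` (limits of the Wilson states on the symmetric tori `Λ_{L_k+1}⁴`), every axis permutation
`σ ∈ S₄` and every bounded continuous cylinder observable `F`: `∫ F(relabelConfig (edgePerm σ) U) dμ = ∫ F dμ`.

Proof (the tree's B-TI pattern `integral_comp_configShift_of_mem_limitPoints`, with permutations for translations): the DLR-side
relabelling `relabelConfig (edgePerm σ)` (`LatticeGaugeDLRSymmetry`) IS the Wave-0-side `configPermZd σ` (`rfl`); the periodic lift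
intertwines `configPermZd σ` with the torus axis permutation `configPerm σ` (`toTorusObservable_comp_configPermZd`), under which every
torus Wilson state is invariant (`wilsonExpectation_comp_configPerm`: the symmetric torus and the Wilson action are hypercubic-invariant);
so `∫ F∘(configPermZd σ) dμ` and `∫ F dμ` are limits of the SAME sequence of torus expectations.  No second countability of `G` and no
simplicity of `G` is used (the hypothesis `IsCompactSimpleLieGroup G` is idle).  Compare `GaugeBoot.ClassBLimitSymmetry`
(`permInvariant_of_mem_infiniteVolumeLimitPoints`, the measure-level statement under second countability).

References: E. Seiler, LNP 159 (1982) Ch. 2 (hypercubic symmetry of the Wilson action); H.-O. Georgii, Gibbs Measures and Phase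
Transitions (2011) §5.1 (symmetries of limit states).
-/

set_option autoImplicit false

noncomputable section

open MeasureTheory Filter Topology
open Literature.MathematicalPhysics Literature.MathematicalPhysics.QuantumFieldTheory
  Literature.MathematicalPhysics.QuantumLattice

namespace Summit.QuantumFields.YangMills.Theorems.SteinGapBootstrap

section Perm

variable {N : ℕ} {G : Type} [Group G] [TopologicalSpace G] [IsTopologicalGroup G] [CompactSpace G]
  [MeasurableSpace G] [BorelSpace G] (ρ : G →* Matrix (Fin N) (Fin N) ℂ)

omit [Group G] [TopologicalSpace G] [IsTopologicalGroup G] [CompactSpace G] [BorelSpace G] in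
/-- The DLR-side relabelling along the edge permutation induced by an axis permutation `σ` is the Wave-0-side `configPermZd σ`.
[cite: SeilerLNP1982, Ch. 2] -/
theorem relabelConfig_edgePerm_eq_configPermZd (σ : Equiv.Perm (Fin 4)) :
    (relabelConfig (G := G) (edgePerm σ) : LGConfig 4 G → LGConfig 4 G) = configPermZd (G := G) σ := by
  funext U e
  rw [relabelConfig_apply, configPermZd_apply]
  rfl

/-- **Axis-permutation invariance of torus-limit states on bounded continuous cylinder observables** (every compact `G`, continuous
model `ρ`, real `β`, any subsequence of torus sides): `∫ F(configPermZd σ U) dμ = ∫ F dμ`. [cite: SeilerLNP1982, Ch. 2] -/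
theorem integral_comp_configPermZd_of_mem_limitPoints (hρ : Continuous ρ) {β : ℝ} {μ : Measure (LGConfig 4 G)}
    (hμ : μ ∈ infiniteVolumeLimitPoints (d := 4) ρ β) (σ : Equiv.Perm (Fin 4))
    {F : LGConfig 4 G → ℝ} {S : Finset (QuantumLattice.ZdEdge 4)}
    (hFS : IsCylinder F S) (hFc : Continuous F) (hFb : ∃ C, ∀ U, |F U| ≤ C) :
    ∫ U, F (configPermZd σ U) ∂μ = ∫ U, F U ∂μ := by
  obtain ⟨L, _hL, _hprob, hconv⟩ := hμ
  have h1 := hconv (F ∘ configPermZd σ) _ (IsCylinder.comp_configPermZd hFS σ)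
    (hFc.comp (continuous_configPermZd σ)) (by obtain ⟨C, hC⟩ := hFb; exact ⟨C, fun U => hC _⟩)
  have h2 := hconv F S hFS hFc hFb
  have hE : (fun k : ℕ => wilsonExpectation (L := L k + 1) ρ β
      (toTorusObservable (L k + 1) (F ∘ configPermZd σ))) =
      fun k : ℕ => wilsonExpectation (L := L k + 1) ρ β (toTorusObservable (L k + 1) F) := by
    funext k
    rw [toTorusObservable_comp_configPermZd, wilsonExpectation_comp_configPerm ρ hρ]
  rw [hE] at h1
  exact tendsto_nhds_unique h1 h2

end Perm

/-- **Support item `AxisSymmetryG` of route `SteinGapBootstrap` (stmt-QuantumFields-23001), PROVED**: every torus-limit state of the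
`d = 4` Wilson theory (every compact simple `G`, faithful unitary `r`, real `β`) is invariant, on bounded continuous cylinder
observables, under the coordinate permutations `relabelConfig (edgePerm σ)`. [cite: SeilerLNP1982, Ch. 2] -/
theorem axisSymmetryG_proof : Summit.QuantumFields.YangMills.Theses.SteinGapBootstrap.AxisSymmetryG := by
  intro G _ _ _ _ _hG
  letI : MeasurableSpace G := borel G
  haveI : BorelSpace G := ⟨rfl⟩
  intro r β μ hμ σ F S hFS hFc hFb
  rw [relabelConfig_edgePerm_eq_configPermZd]
  exact integral_comp_configPermZd_of_mem_limitPoints r.ρ r.continuous hμ σ hFS hFc hFb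

end Summit.QuantumFields.YangMills.Theorems.SteinGapBootstrap

end
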